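import Mathlib
import HarnessLib
import Literature.Analysis.FluidPDE.Tao2016AveragedNS.TaylorChainCertificate
import Summits.NavierStokesRegularity.NavierStokesRegularity.Theorems.TaylorModelRungThreeReadoutCoords
import Summits.NavierStokesRegularity.NavierStokesRegularity.Theorems.TaylorModelRungThreeReadoutPackage
import Summits.NavierStokesRegularity.NavierStokesRegularity.Theorems.TaylorModelRungThreeReadoutFlow

/-!
# Line `taylor-model` on crux K1b-DR (stmt-NavierStokesRegularity-23954) — stub G2 `stub_crossing`, helper 1:
# the abstract crossing lemma, chain timing, and the section functional along the flow

Helper file toward the registered stub `stub_crossing : CrossingReadouts` of skeleton v4.1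
(`42b6425f90a56974`, line owner ns-idea-2 g3; G-STUBPLANS §G2, first lemmas L2.1–L2.3), over the landed G0
vocabulary `…TaylorModelRungThreeReadoutPackage` (`tauSel`, `Crossing`, `ChainEnclosure`, `SolvesOn`, `InPoly`)
and the certificate record `TaylorChain.CertData` (Literature, p593471).  Namespace `…TaylorModelReadout.G2`:

* `exists_isLeast_crossing` — the abstract crossing lemma (critic P-TM5 «`tauSel = sInf` needs the crossing set
  nonempty + closed»): a continuous, strictly increasing `g` on `[a, b]` with `g a < lev < g b` has a unique
  level time `τ ∈ (a, b]`; the super-level set `{t | a ≤ t ≤ b, lev ≤ g t}` is the closed interval `[τ, b]`,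
  so its infimum is ATTAINED (`IsLeast`), `g < lev` before `τ`, `g > lev` after;
* chain timing (`Tn_mono`, `Tn_nonneg`, `Tn_last`, `exists_substep`: every time of `[0, Tn S]` lies in a
  sub-step);
* the section functional SEES ONLY THE WINDOW (`sigma_eq_of_window` / `sigma_trunc` = L2.1, from its unit-ball
  bound `Nσ` and `ω > 0`), hence factors through the finite-dimensional window coordinates (a continuous
  linear map there); along a solution of K1b-DR's ODE clause `t ↦ σf (φ(q,t))` has derivative
  `σf (Qb (φ, φ))` within `[0, T]` (`hasDerivWithinAt_sigma`) and is continuous (`continuousOn_sigma` = L2.2);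
* accessors `valid_*` into the clauses of a valid certificate used by G2.

MODEL-lattice bookkeeping only (rung TL-M3 of the NS ladder); nothing here is a statement about the
Navier–Stokes equations, and K1b-DR is not proved here.
-/

noncomputable section

-- the sub-problem namespace repeats the summit name by design (D-0017)
set_option linter.dupNamespace false

namespace Summit.NavierStokesRegularity.NavierStokesRegularity.Theorems.TaylorModelReadout.G2

open Set Literature.Analysis.FluidPDE.TaoCascade Literature.Analysis.FluidPDE.TaoCascade.TaylorChain

variable {cd : CertData}

/-! ### The abstract crossing lemma -/

/-- **Crossing of a level by a continuous strictly increasing function** (the fact behind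
`tauSel = sInf {…}`): if `g` is continuous and strictly increasing on `[a, b]` with `g a < lev < g b`, then
there is `τ` with `a < τ ≤ b`, `g τ = lev`, `g < lev` on `[a, τ)`, `g > lev` on `(τ, b]`, and `τ` is the LEAST
element of the (closed, nonempty) super-level set `{t | a ≤ t ∧ t ≤ b ∧ lev ≤ g t}` — so its infimum is
attained. [folklore] -/
theorem exists_isLeast_crossing {g : ℝ → ℝ} {a b lev : ℝ} (hab : a ≤ b) (hg : ContinuousOn g (Icc a b))
    (hmono : StrictMonoOn g (Icc a b)) (ha : g a < lev) (hb : lev < g b) :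
    ∃ τ, IsLeast {t : ℝ | a ≤ t ∧ t ≤ b ∧ lev ≤ g t} τ ∧ a < τ ∧ τ ≤ b ∧ g τ = lev ∧
      (∀ t, a ≤ t → t < τ → g t < lev) ∧ (∀ t, τ < t → t ≤ b → lev < g t) := by
  obtain ⟨τ, hτ, hgτ⟩ : ∃ τ ∈ Icc a b, g τ = lev := intermediate_value_Icc hab hg ⟨ha.le, hb.le⟩
  have haτ : a < τ := by
    rcases hτ.1.eq_or_lt with h | h
    · rw [h] at ha
      exact absurd hgτ ha.ne
    · exact h
  have hbefore : ∀ t, a ≤ t → t < τ → g t < lev := by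
    intro t hat htτ
    rw [← hgτ]
    exact hmono ⟨hat, htτ.le.trans hτ.2⟩ hτ htτ
  have hafter : ∀ t, τ < t → t ≤ b → lev < g t := by
    intro t hτt htb
    rw [← hgτ]
    exact hmono hτ ⟨hτ.1.trans hτt.le, htb⟩ hτt
  refine ⟨τ, ⟨⟨hτ.1, hτ.2, hgτ.symm.le⟩, fun t ht => ?_⟩, haτ, hτ.2, hgτ, hbefore, hafter⟩
  by_contra h
  exact absurd ht.2.2 (not_le.2 (hbefore t ht.1 (not_le.1 h)))

/-! ### Chain timing -/

/-- Nodes increase along a chain: `Tn j s ≤ Tn j (s + d)` while `s + d ≤ S j`. [folklore] -/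
theorem Tn_mono_aux (hCh : cd.Chain) {j : ℕ} (hj : j ≤ cd.N₀) (s : ℕ) :
    ∀ d : ℕ, s + d ≤ cd.S j → cd.Tn j s ≤ cd.Tn j (s + d)
  | 0, _ => by simp
  | d + 1, h => by
    have hlt : s + d < cd.S j := by omega
    obtain ⟨hpos, -, -, hsucc, -⟩ := (hCh j hj).2.2.2.2.2.2.2 (s + d) hlt
    have ih := Tn_mono_aux hCh hj s d hlt.le
    rw [← add_assoc, hsucc]
    linarith

/-- Nodes increase along a chain: `Tn j s ≤ Tn j s'` for `s ≤ s' ≤ S j`. [folklore] -/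
theorem Tn_mono (hCh : cd.Chain) {j : ℕ} (hj : j ≤ cd.N₀) {s s' : ℕ} (hss' : s ≤ s') (hs' : s' ≤ cd.S j) :
    cd.Tn j s ≤ cd.Tn j s' := by
  obtain ⟨d, rfl⟩ := Nat.exists_eq_add_of_le hss'
  exact Tn_mono_aux hCh hj s d hs'

/-- Nodes are non-negative (`Tn j 0 = 0`). [folklore] -/
theorem Tn_nonneg (hCh : cd.Chain) {j : ℕ} (hj : j ≤ cd.N₀) {s : ℕ} (hs : s ≤ cd.S j) : 0 ≤ cd.Tn j s := by
  have h := Tn_mono hCh hj (Nat.zero_le s) hs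
  rwa [(hCh j hj).2.1] at h

/-- The stage horizon is the end of the last sub-step: `Tn j S = Tn j (S-1) + h j (S-1)`. [folklore] -/
theorem Tn_last (hCh : cd.Chain) {j : ℕ} (hj : j ≤ cd.N₀) :
    cd.Tn j (cd.S j) = cd.Tn j (cd.S j - 1) + cd.h j (cd.S j - 1) := by
  have hS : 1 ≤ cd.S j := (hCh j hj).1
  obtain ⟨-, -, -, h, -⟩ := (hCh j hj).2.2.2.2.2.2.2 (cd.S j - 1) (by omega)
  rwa [Nat.sub_add_cancel hS] at h

/-- Step location for a real sequence: if `f 0 ≤ t ≤ f (n+1)` then `f m ≤ t ≤ f (m+1)` for some `m ≤ n`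
(no monotonicity needed). [folklore] -/
theorem exists_step_index {f : ℕ → ℝ} {t : ℝ} :
    ∀ n : ℕ, f 0 ≤ t → t ≤ f (n + 1) → ∃ m, m ≤ n ∧ f m ≤ t ∧ t ≤ f (m + 1)
  | 0, h0, h1 => ⟨0, le_rfl, h0, h1⟩
  | n + 1, h0, h1 => by
    by_cases h : t ≤ f (n + 1)
    · obtain ⟨m, hm, hm1, hm2⟩ := exists_step_index n h0 h
      exact ⟨m, hm.trans (Nat.le_succ n), hm1, hm2⟩
    · exact ⟨n + 1, le_rfl, (not_le.1 h).le, h1⟩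

/-- Every time `t ∈ [0, Tn j S]` of the stage horizon lies in some sub-step `[Tn j s', Tn j (s'+1)]`,
`s' < S j`. [folklore] -/
theorem exists_substep (hCh : cd.Chain) {j : ℕ} (hj : j ≤ cd.N₀) {t : ℝ} (ht0 : 0 ≤ t)
    (ht1 : t ≤ cd.Tn j (cd.S j)) : ∃ s', s' < cd.S j ∧ cd.Tn j s' ≤ t ∧ t ≤ cd.Tn j (s' + 1) := by
  have hS : 1 ≤ cd.S j := (hCh j hj).1
  have h0 : cd.Tn j 0 ≤ t := by rw [(hCh j hj).2.1]; exact ht0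
  have h1 : t ≤ cd.Tn j (cd.S j - 1 + 1) := by rw [Nat.sub_add_cancel hS]; exact ht1
  obtain ⟨m, hm, hm1, hm2⟩ := exists_step_index (f := cd.Tn j) (cd.S j - 1) h0 h1
  exact ⟨m, by omega, hm1, hm2⟩

/-! ### The section functional: window support, window coordinates, derivative along the flow -/

/-- **The section functional sees only the window**: a linear functional bounded by `Nσ` on the weighted
unit window-ball (which constrains window components only) vanishes on every vector with zero window
components, so it takes equal values on states that agree on the window. [folklore] -/
theorem sigma_eq_of_window {j : ℕ} (hω : ∀ k, 0 < cd.ω j k)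
    (hN : ∀ v, cd.InBall j v 1 → |cd.σf j v| ≤ cd.Nσ j) {y y' : Fin 4 → ℤ → ℝ}
    (h : ∀ i k, -cd.Kb ≤ k → k ≤ cd.Ka → y i k = y' i k) : cd.σf j y = cd.σf j y' := by
  have hw : ∀ c : ℝ, cd.InBall j (c • (y - y')) 1 := by
    intro c i k hk1 hk2
    have h0 : (c • (y - y')) i k = 0 := by simp [h i k hk1 hk2]
    rw [h0, abs_zero, one_mul]
    exact (hω k).le
  by_contra hne
  have hd : cd.σf j (y - y') ≠ 0 := by rwa [map_sub, sub_ne_zero]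
  have h1 := hN _ (hw ((cd.Nσ j + 1) / cd.σf j (y - y')))
  rw [map_smul, smul_eq_mul, div_mul_cancel₀ _ hd] at h1
  have h0 := hN _ (hw 0)
  rw [zero_smul, map_zero, abs_zero] at h0
  linarith [le_abs_self (cd.Nσ j + 1)]

/-- L2.1 of the stub plan: `σf v = σf (trunc v)`. [folklore] -/
theorem sigma_trunc {j : ℕ} (hω : ∀ k, 0 < cd.ω j k) (hN : ∀ v, cd.InBall j v 1 → |cd.σf j v| ≤ cd.Nσ j)
    (v : Fin 4 → ℤ → ℝ) : cd.σf j v = cd.σf j (trunc cd v) :=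
  sigma_eq_of_window hω hN fun i k hk1 hk2 => by simp [hk1, hk2]

/-- **Derivative of the section value along a solution** of K1b-DR's ODE clause on `[0, T]`:
`d/dt σf (φ(q,t)) = σf (Qb (φ(q,t), φ(q,t)))` (within `[0, T]`).  The section functional is read in the
finite-dimensional window coordinates (`σf = L ∘ toVec` with `L := σf ∘ ofVec`, continuous there), the window
path `t ↦ toVec (φ(q,t))` has derivative `toVec (qT (φ(q,t)))` componentwise by the ODE clause, and
`Qb (y, y) = qT y`. [folklore] -/
theorem hasDerivWithinAt_sigma {j : ℕ} (hω : ∀ k, 0 < cd.ω j k)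
    (hN : ∀ v, cd.InBall j v 1 → |cd.σf j v| ≤ cd.Nσ j) {φ : Flow} {q : Fin 4 → ℤ → ℝ} {T : ℝ}
    (hsol : SolvesOn cd φ j q T) {t : ℝ} (ht : t ∈ Icc 0 T) :
    HasDerivWithinAt (fun s => cd.σf j (stAt φ j q s))
      (cd.σf j (cd.Qb (stAt φ j q t) (stAt φ j q t))) (Icc 0 T) t := by
  -- the section functional in window coordinates: a continuous linear map on `Fin (nW cd) → ℝ`
  let L : (Fin (nW cd) → ℝ) →L[ℝ] ℝ :=
    LinearMap.toContinuousLinearMap ((cd.σf j).comp (IsLinearMap.mk' (ofVec cd) ⟨ofVec_add cd, ofVec_smul cd⟩))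
  have hL : ∀ y : Fin 4 → ℤ → ℝ, cd.σf j y = L (toVec cd y) := by
    intro y
    show cd.σf j y = cd.σf j (ofVec cd (toVec cd y))
    rw [ofVec_toVec]
    exact sigma_trunc hω hN y
  have hX : HasDerivWithinAt (fun s => toVec cd (stAt φ j q s)) (toVec cd (cd.qT (stAt φ j q t)))
      (Icc 0 T) t := by
    refine hasDerivWithinAt_pi.2 fun c => ?_
    have hk := shellOf_mem cd c
    have h1 := (hsol (modeOf cd c) (shellOf cd c) hk.1 hk.2).2 t ht
    rw [quadTerm_trunc_eq_qT (cd := cd) _ _ hk] at h1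
    exact h1
  have h2 := L.hasFDerivAt.comp_hasDerivWithinAt t hX
  have hfun : (fun s => cd.σf j (stAt φ j q s)) = ⇑L ∘ fun s => toVec cd (stAt φ j q s) := by
    funext s
    exact hL _
  have hval : L (toVec cd (cd.qT (stAt φ j q t))) = cd.σf j (cd.Qb (stAt φ j q t) (stAt φ j q t)) := by
    rw [Qb_self, ← hL]
  rw [hfun, ← hval]
  exact h2

/-- The section value is continuous along a solution on `[0, T]`. [folklore] -/
theorem continuousOn_sigma {j : ℕ} (hω : ∀ k, 0 < cd.ω j k)
    (hN : ∀ v, cd.InBall j v 1 → |cd.σf j v| ≤ cd.Nσ j) {φ : Flow} {q : Fin 4 → ℤ → ℝ} {T : ℝ}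
    (hsol : SolvesOn cd φ j q T) : ContinuousOn (fun s => cd.σf j (stAt φ j q s)) (Icc 0 T) :=
  fun _ ht => (hasDerivWithinAt_sigma hω hN hsol ht).continuousWithinAt

/-! ### Accessors into a valid certificate -/

/-- Weights are positive. [folklore] -/
theorem valid_omega_pos (hV : cd.Valid) {j : ℕ} (hj : j ≤ cd.N₀) : ∀ k, 0 < cd.ω j k :=
  (hV.2.1.1 j hj).2.2.2.2.2.2.1

/-- The tube radius is positive. [folklore] -/
theorem valid_kappa_pos (hV : cd.Valid) {j : ℕ} (hj : j ≤ cd.N₀) : 0 < cd.κ j := (hV.2.1.1 j hj).2.2.2.1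
/-- At least one sub-step. [folklore] -/
theorem valid_one_le_S (hV : cd.Valid) {j : ℕ} (hj : j ≤ cd.N₀) : 1 ≤ cd.S j := (hV.2.2.1 j hj).1
/-- The stage horizon is at most `τs`. [folklore] -/
theorem valid_Tn_le (hV : cd.Valid) {j : ℕ} (hj : j ≤ cd.N₀) : cd.Tn j (cd.S j) ≤ cd.τs := (hV.2.2.1 j hj).2.2.1
/-- The base centre `x j 0` lies in the entry polytope. [folklore] -/
theorem valid_inPoly_x0 (hV : cd.Valid) {j : ℕ} (hj : j ≤ cd.N₀) : InPoly cd j (cd.x j 0) :=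
  (hV.2.2.1 j hj).2.2.2.2.1

/-- The window `M`-bound clause of sub-step `s'`. [folklore] -/
theorem valid_M_clause (hV : cd.Valid) {j : ℕ} (hj : j ≤ cd.N₀) {s' : ℕ} (hs' : s' < cd.S j) :
    ∀ u ∈ Icc 0 (cd.h j s'), ∀ w' : (Fin 4 → ℤ → ℝ), cd.InBall j w' (cd.SpO j s') →
      ∀ i k, -cd.Kb ≤ k → k ≤ cd.Ka →
        |(cd.TP j s' u + w') i k| ≤ cd.M k - cd.Λ j * cd.δ j * cd.τs * cd.ω j k - cd.mm := by
  obtain ⟨-, -, -, -, -, -, -, -, -, -, -, -, -, -, -, -, -, -, -, -, -, -, hM⟩ :=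
    (hV.2.2.1 j hj).2.2.2.2.2.2.2 s' hs'
  exact hM

/-- A sub-step ends at `Tn j (s'+1) = Tn j s' + h j s'`. [folklore] -/
theorem valid_Tn_succ (hV : cd.Valid) {j : ℕ} (hj : j ≤ cd.N₀) {s' : ℕ} (hs' : s' < cd.S j) :
    cd.Tn j (s' + 1) = cd.Tn j s' + cd.h j s' :=
  ((hV.2.2.1 j hj).2.2.2.2.2.2.2 s' hs').2.2.2.1

/-- Transversality margin `0 < γ j`. [folklore] -/
theorem valid_gamma_pos (hV : cd.Valid) {j : ℕ} (hj : j ≤ cd.N₀) : 0 < cd.γ j := (hV.2.2.2 j hj).2.1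

/-- Unit-ball bound `Nσ j` of the section functional. [folklore] -/
theorem valid_sigma_bound (hV : cd.Valid) {j : ℕ} (hj : j ≤ cd.N₀) :
    ∀ v, cd.InBall j v 1 → |cd.σf j v| ≤ cd.Nσ j := (hV.2.2.2 j hj).2.2.1

/-- The section value is below the level on the node box of node `S-1`. [folklore] -/
theorem valid_sigma_start (hV : cd.Valid) {j : ℕ} (hj : j ≤ cd.N₀) :
    ∀ ξ e : (Fin 4 → ℤ → ℝ), (∀ i k, -cd.Kb ≤ k → k ≤ cd.Ka → |ξ i k| ≤ cd.rP j (cd.S j - 1) i k) →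
      cd.InBall j e (cd.E j (cd.S j - 1)) →
        cd.σf j (cd.x j (cd.S j - 1) + cd.Cm j (cd.S j - 1) ξ + e) < cd.lev j :=
  (hV.2.2.2 j hj).2.2.2.1

/-- The section value is above the level on the node box of node `S`. [folklore] -/
theorem valid_sigma_end (hV : cd.Valid) {j : ℕ} (hj : j ≤ cd.N₀) :
    ∀ ξ e : (Fin 4 → ℤ → ℝ), (∀ i k, -cd.Kb ≤ k → k ≤ cd.Ka → |ξ i k| ≤ cd.rP j (cd.S j) i k) →
      cd.InBall j e (cd.E j (cd.S j)) → cd.lev j < cd.σf j (cd.x j (cd.S j) + cd.Cm j (cd.S j) ξ + e) :=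
  (hV.2.2.2 j hj).2.2.2.2.1

/-- Transversality `γ ≤ σf (Qb (y, y))` on the last sub-step's in-step enclosure. [folklore] -/
theorem valid_transversal (hV : cd.Valid) {j : ℕ} (hj : j ≤ cd.N₀) :
    ∀ u ∈ Icc 0 (cd.h j (cd.S j - 1)), ∀ w' : (Fin 4 → ℤ → ℝ), cd.InBall j w' (cd.Sp j (cd.S j - 1)) →
      cd.γ j ≤ cd.σf j (cd.Qb (cd.TP j (cd.S j - 1) u + w') (cd.TP j (cd.S j - 1) u + w')) :=
  (hV.2.2.2 j hj).2.2.2.2.2.1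

/-- The (E1) read-out clause at crossing states of the last sub-step. [folklore] -/
theorem valid_readE1 (hV : cd.Valid) {j : ℕ} (hj : j ≤ cd.N₀) :
    ∀ u ∈ Icc 0 (cd.h j (cd.S j - 1)), ∀ w' : (Fin 4 → ℤ → ℝ), cd.InBall j w' (cd.Sp j (cd.S j - 1)) →
      cd.σf j (cd.TP j (cd.S j - 1) u + w') = cd.lev j →
        cd.as j ≤ |(cd.TP j (cd.S j - 1) u + w') cd.i₀ 1| ∧
        (∀ i, |(cd.TP j (cd.S j - 1) u + w') i (-cd.Kb)| + cd.Λ j * cd.δ j * cd.τs * cd.ω j (-cd.Kb) ≤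
          (2:ℝ) ^ (-cd.θ) * (cd.Cb * (2:ℝ) ^ ((3:ℝ)/4 * ((cd.Kb:ℝ) + 1)))) ∧
        (∀ (v : Fin 4 → ℝ) (l : ℕ), (∀ i, |v i| ≤ Real.sqrt (10*cd.Cg*(2:ℝ) ^ (-(7:ℝ)*((cd.Ka:ℝ) + 1)))) →
          ∀ z : (Fin 4 → ℤ → ℝ), cd.InBall j z 1 →
            |cd.ℓ (cd.nx j) l (cd.landD j (cd.TP j (cd.S j - 1) u + w') v z)| ≤ cd.NDL j l) :=
  (hV.2.2.2 j hj).2.2.2.2.2.2.1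

end Summit.NavierStokesRegularity.NavierStokesRegularity.Theorems.TaylorModelReadout.G2

end
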